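import Summits.QuantumFields.YangMills.Theorems.SwapVirialDeficitBlowUpGnomonicTipRotTransverse
import Summits.QuantumFields.YangMills.Theorems.SwapVirialDeficitBlowUpGnomonicCrossFloor
import Summits.QuantumFields.YangMills.Theorems.SwapVirialDeficitBlowUpGnomonicLeaderGroupDistApex
import HarnessLib

/-!
# The three caps of the tip core, the axis-permuting quaternion, and the cap-0 group distance

Sub-problem `SwapVirialDeficit`, crux ⟨stmt-QuantumFields-24197⟩ `SwapGluedStiffness`, skeleton ➎, stub `stub_core_tip`, socket (hCore); w3 g68's design revision
(STATUS 01:40Z): the e₀-adapted joint/relative letters `(p, τ⃗, ρ⃗)` are singular where the joint axis is `⊥ e₀`; the cure is to cover leader space by the three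
CAPS `R_i = {Σ_{j≠i}(x_j² + y_j²) ≤ 3(x_i² + y_i²)}` and to use `e_i`-adapted letters on `R_i`, where the tilts are BOUNDED (`|τ⃗|² + |ρ⃗|² ≤ 3`).
* `tip_caps_cover` — every `(x, y)` lies in some `R_i`; `measurableSet_tipCap0/1/2`; ★ `lintegral_le_tipCaps` — `∫⁻ g ≤ Σ_i ∫⁻ 𝟙_{R_i} g`.
* ★ `exists_capQuat` — a unit quaternion `q` (= `(1+i+j+k)/2`) with `rot3 q v = (v₁, v₂, v₀)` and `rot3 (q·q) v = (v₂, v₀, v₁)`: `gnoRot q` maps `R₁` onto `R₀`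
  and `gnoRot (q·q)` maps `R₂` onto `R₀` (`gnoRot_capQuat_mem_cap0`, `gnoRot_capQuat_sq_mem_cap0`), so every cap-0 lemma transports (✓`volume_preserving_gnoRot`,
  ✓`gnoDensity_gnoRot`, ✓`gnoDeficit_gnoRot_eq_cart`).
* `jointRel_cap0_iff` — in joint/relative letters over `p ≠ 0` the cap-0 condition reads `|τ⃗|² + |ρ⃗|² ≤ 3`.
* `tipRot_letters_of_rot` — ✓`tipRot_letters` for EVERY unit `u` with `rot3 u e₀ = (1,τ⃗)/λ`; `tipRot_axial` — the axial letters of `ζ = gnoRot ū η` are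
  `(λx₀ − y₀(τ⃗·ρ⃗)/λ, λy₀ + x₀(τ⃗·ρ⃗)/λ)` exactly; `normSq3_tipRot` — `|ζ.x|² = |x|²`, `|ζ.y|² = |y|²`, `|ζ.z|² = |z|²`.
* ★★ `tip_transverse_compressed_le` — `|ζ.x⊥|²/(1+|x|²) ≤ 450L⁶F̂(η)·(1+|y|²)/|p|²` (and the `y` twin) for ANY tilts, from ✓`tipRot_transverse_sq` +
  ✓`gnoDeficit_floor_cross`; on `R₀` one has `1+|y|² ≤ 1+4|p|²`, so with ✓`leaderGroupDist_le_apex` (w2 g61) at the base point `gnoBase (ζ.x₀) (ζ.y₀)` the K7g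
  distance is `≤ 2√(900L⁶F̂(1+4|p|²)/|p|²) + √(3600L⁶F̂)` — uniform in the tilts, explicit in the corner.

HONEST LABEL: letter bookkeeping only; (hCore), `stub_core_tip`, ⟨24197⟩, ⟨24194⟩ remain OPEN; nothing here proves the Yang–Mills mass gap.
-/

noncomputable section

open MeasureTheory Quaternion Set
open scoped Quaternion BigOperators ENNReal
open Literature.MathematicalPhysics.QuantumLattice
open Literature.MathematicalPhysics.QuantumFieldTheory hiding SU2
open Literature.Analysis.Calculus (radialUnit radialUnit_def norm_radialUnit)

namespace Summit.QuantumFields.YangMills.Theorems.SwapVirialDeficit.BlowUpRing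

open Summit.QuantumFields.YangMills.Theorems.FemtoTransferGap
open Summit.QuantumFields.YangMills.Theorems.FemtoTransferGap.TT
open Summit.QuantumFields.YangMills.Theorems.VirialFluxGap.RingDeficit
open Summit.QuantumFields.YangMills.Theorems.SwapVirialDeficit.SwapRing
open Summit.QuantumFields.YangMills.Theorems.SwapVirialDeficit.Gnomonic (normSq3)

variable {L : ℕ} [NeZero L]

/-! ## §1 The three caps cover -/

omit [NeZero L] in
/-- ★ **THE THREE CAPS COVER**: for all leader letters `x, y`, some coordinate `i` carries at least a quarter of `|x|² + |y|²`:
`Σ_{j≠i}(x_j²+y_j²) ≤ 3(x_i²+y_i²)` for `i = 0`, `1` or `2`. [folklore] -/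
theorem tip_caps_cover (x y : Fin 3 → ℝ) :
    (x 1) ^ 2 + (x 2) ^ 2 + (y 1) ^ 2 + (y 2) ^ 2 ≤ 3 * ((x 0) ^ 2 + (y 0) ^ 2) ∨
      (x 0) ^ 2 + (x 2) ^ 2 + (y 0) ^ 2 + (y 2) ^ 2 ≤ 3 * ((x 1) ^ 2 + (y 1) ^ 2) ∨
      (x 0) ^ 2 + (x 1) ^ 2 + (y 0) ^ 2 + (y 1) ^ 2 ≤ 3 * ((x 2) ^ 2 + (y 2) ^ 2) := by
  by_contra h
  push Not at h
  obtain ⟨h0, h1, h2⟩ := h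
  nlinarith [sq_nonneg (x 0), sq_nonneg (x 1), sq_nonneg (x 2), sq_nonneg (y 0), sq_nonneg (y 1), sq_nonneg (y 2)]

omit [NeZero L] in
/-- `R₀` is measurable. [folklore] -/
theorem measurableSet_tipCap0 :
    MeasurableSet {η : GnoCoord L | (η.1.1 1) ^ 2 + (η.1.1 2) ^ 2 + (η.1.2 1) ^ 2 + (η.1.2 2) ^ 2 ≤ 3 * ((η.1.1 0) ^ 2 + (η.1.2 0) ^ 2)} := by
  have hx : ∀ i : Fin 3, Measurable fun η : GnoCoord L => η.1.1 i := fun i => (measurable_pi_apply i).comp (measurable_fst.comp measurable_fst)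
  have hy : ∀ i : Fin 3, Measurable fun η : GnoCoord L => η.1.2 i := fun i => (measurable_pi_apply i).comp (measurable_snd.comp measurable_fst)
  exact measurableSet_le (by fun_prop) (by fun_prop)

omit [NeZero L] in
/-- `R₁` is measurable. [folklore] -/
theorem measurableSet_tipCap1 :
    MeasurableSet {η : GnoCoord L | (η.1.1 0) ^ 2 + (η.1.1 2) ^ 2 + (η.1.2 0) ^ 2 + (η.1.2 2) ^ 2 ≤ 3 * ((η.1.1 1) ^ 2 + (η.1.2 1) ^ 2)} := by
  have hx : ∀ i : Fin 3, Measurable fun η : GnoCoord L => η.1.1 i := fun i => (measurable_pi_apply i).comp (measurable_fst.comp measurable_fst)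
  have hy : ∀ i : Fin 3, Measurable fun η : GnoCoord L => η.1.2 i := fun i => (measurable_pi_apply i).comp (measurable_snd.comp measurable_fst)
  exact measurableSet_le (by fun_prop) (by fun_prop)

omit [NeZero L] in
/-- `R₂` is measurable. [folklore] -/
theorem measurableSet_tipCap2 :
    MeasurableSet {η : GnoCoord L | (η.1.1 0) ^ 2 + (η.1.1 1) ^ 2 + (η.1.2 0) ^ 2 + (η.1.2 1) ^ 2 ≤ 3 * ((η.1.1 2) ^ 2 + (η.1.2 2) ^ 2)} := by
  have hx : ∀ i : Fin 3, Measurable fun η : GnoCoord L => η.1.1 i := fun i => (measurable_pi_apply i).comp (measurable_fst.comp measurable_fst)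
  have hy : ∀ i : Fin 3, Measurable fun η : GnoCoord L => η.1.2 i := fun i => (measurable_pi_apply i).comp (measurable_snd.comp measurable_fst)
  exact measurableSet_le (by fun_prop) (by fun_prop)

omit [NeZero L] in
/-- ★ **SPLITTING AN INTEGRAL OVER THE CAPS**: `∫⁻ g ≤ ∫⁻ 𝟙_{R₀}g + ∫⁻ 𝟙_{R₁}g + ∫⁻ 𝟙_{R₂}g` for measurable `g ≥ 0` on `GnoCoord L` (any measure). [folklore] -/
theorem lintegral_le_tipCaps (μ : Measure (GnoCoord L)) {g : GnoCoord L → ℝ≥0∞} (hg : Measurable g) :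
    ∫⁻ η, g η ∂μ ≤
      ∫⁻ η, {η : GnoCoord L | (η.1.1 1) ^ 2 + (η.1.1 2) ^ 2 + (η.1.2 1) ^ 2 + (η.1.2 2) ^ 2 ≤ 3 * ((η.1.1 0) ^ 2 + (η.1.2 0) ^ 2)}.indicator g η ∂μ +
        ∫⁻ η, {η : GnoCoord L | (η.1.1 0) ^ 2 + (η.1.1 2) ^ 2 + (η.1.2 0) ^ 2 + (η.1.2 2) ^ 2 ≤ 3 * ((η.1.1 1) ^ 2 + (η.1.2 1) ^ 2)}.indicator g η ∂μ +
        ∫⁻ η, {η : GnoCoord L | (η.1.1 0) ^ 2 + (η.1.1 1) ^ 2 + (η.1.2 0) ^ 2 + (η.1.2 1) ^ 2 ≤ 3 * ((η.1.1 2) ^ 2 + (η.1.2 2) ^ 2)}.indicator g η ∂μ := by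
  have hS0 := measurableSet_tipCap0 (L := L)
  have hS1 := measurableSet_tipCap1 (L := L)
  have hS2 := measurableSet_tipCap2 (L := L)
  have hsplit1 := lintegral_add_left (μ := μ) ((hg.indicator hS0).add (hg.indicator hS1))
    ({η : GnoCoord L | (η.1.1 0) ^ 2 + (η.1.1 1) ^ 2 + (η.1.2 0) ^ 2 + (η.1.2 1) ^ 2 ≤ 3 * ((η.1.1 2) ^ 2 + (η.1.2 2) ^ 2)}.indicator g)
  have hsplit2 := lintegral_add_left (μ := μ) (hg.indicator hS0)
    ({η : GnoCoord L | (η.1.1 0) ^ 2 + (η.1.1 2) ^ 2 + (η.1.2 0) ^ 2 + (η.1.2 2) ^ 2 ≤ 3 * ((η.1.1 1) ^ 2 + (η.1.2 1) ^ 2)}.indicator g)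
  simp only [Pi.add_apply] at hsplit1 hsplit2
  rw [← hsplit2, ← hsplit1]
  refine lintegral_mono fun η => ?_
  rcases tip_caps_cover η.1.1 η.1.2 with h | h | h
  · rw [Set.indicator_of_mem (show η ∈ {η : GnoCoord L | (η.1.1 1) ^ 2 + (η.1.1 2) ^ 2 + (η.1.2 1) ^ 2 + (η.1.2 2) ^ 2 ≤ 3 * ((η.1.1 0) ^ 2 + (η.1.2 0) ^ 2)} from h)]
    exact le_add_right (le_add_right le_rfl)
  · rw [Set.indicator_of_mem (show η ∈ {η : GnoCoord L | (η.1.1 0) ^ 2 + (η.1.1 2) ^ 2 + (η.1.2 0) ^ 2 + (η.1.2 2) ^ 2 ≤ 3 * ((η.1.1 1) ^ 2 + (η.1.2 1) ^ 2)} from h)]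
    exact le_add_right (le_add_left le_rfl)
  · rw [Set.indicator_of_mem (show η ∈ {η : GnoCoord L | (η.1.1 0) ^ 2 + (η.1.1 1) ^ 2 + (η.1.2 0) ^ 2 + (η.1.2 1) ^ 2 ≤ 3 * ((η.1.1 2) ^ 2 + (η.1.2 2) ^ 2)} from h)]
    exact le_add_left le_rfl

/-! ## §2 The axis-permuting quaternion -/

omit [NeZero L] in
/-- ★ **THE AXIS-PERMUTING UNIT QUATERNION** `q = (1 + i + j + k)/2`: `rot3 q (v₀,v₁,v₂) = (v₁,v₂,v₀)` and `rot3 (q·q) (v₀,v₁,v₂) = (v₂,v₀,v₁)`. [folklore] -/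
theorem exists_capQuat :
    ∃ q : ℍ, ‖q‖ = 1 ∧ (∀ v : Fin 3 → ℝ, rot3 q v = ![v 1, v 2, v 0]) ∧ (∀ v : Fin 3 → ℝ, rot3 (q * q) v = ![v 2, v 0, v 1]) := by
  refine ⟨⟨1 / 2, 1 / 2, 1 / 2, 1 / 2⟩, ?_, ?_, ?_⟩
  · have h := sq_norm_eq_sum_sq (⟨1 / 2, 1 / 2, 1 / 2, 1 / 2⟩ : ℍ)
    norm_num at h
    refine h.resolve_right fun e => ?_
    have h0 := (norm_nonneg _).trans_eq e
    norm_num at h0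
  · intro v
    ext i
    fin_cases i <;> simp [rot3, gnomonicQuat] <;> ring
  · intro v
    ext i
    fin_cases i <;> simp [rot3, gnomonicQuat] <;> ring

omit [NeZero L] in
/-- `gnoRot q` maps the cap `R₁` into `R₀` (for the `q` of `exists_capQuat`). [folklore] -/
theorem gnoRot_capQuat_mem_cap0 {q : ℍ} (hq : ∀ v : Fin 3 → ℝ, rot3 q v = ![v 1, v 2, v 0]) {η : GnoCoord L}
    (h : (η.1.1 0) ^ 2 + (η.1.1 2) ^ 2 + (η.1.2 0) ^ 2 + (η.1.2 2) ^ 2 ≤ 3 * ((η.1.1 1) ^ 2 + (η.1.2 1) ^ 2)) :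
    ((gnoRot q η).1.1 1) ^ 2 + ((gnoRot q η).1.1 2) ^ 2 + ((gnoRot q η).1.2 1) ^ 2 + ((gnoRot q η).1.2 2) ^ 2 ≤
      3 * (((gnoRot q η).1.1 0) ^ 2 + ((gnoRot q η).1.2 0) ^ 2) := by
  obtain ⟨e1, e2, -, -⟩ := gnoRot_apply q η
  rw [e1, e2, hq, hq]
  simp
  linarith

omit [NeZero L] in
/-- `gnoRot (q·q)` maps the cap `R₂` into `R₀`. [folklore] -/
theorem gnoRot_capQuat_sq_mem_cap0 {q : ℍ} (hq : ∀ v : Fin 3 → ℝ, rot3 (q * q) v = ![v 2, v 0, v 1]) {η : GnoCoord L}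
    (h : (η.1.1 0) ^ 2 + (η.1.1 1) ^ 2 + (η.1.2 0) ^ 2 + (η.1.2 1) ^ 2 ≤ 3 * ((η.1.1 2) ^ 2 + (η.1.2 2) ^ 2)) :
    ((gnoRot (q * q) η).1.1 1) ^ 2 + ((gnoRot (q * q) η).1.1 2) ^ 2 + ((gnoRot (q * q) η).1.2 1) ^ 2 + ((gnoRot (q * q) η).1.2 2) ^ 2 ≤
      3 * (((gnoRot (q * q) η).1.1 0) ^ 2 + ((gnoRot (q * q) η).1.2 0) ^ 2) := by
  obtain ⟨e1, e2, -, -⟩ := gnoRot_apply (q * q) η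
  rw [e1, e2, hq, hq]
  simp
  linarith

/-! ## §3 Cap `0` in joint/relative letters -/

omit [NeZero L] in
/-- In joint/relative letters over `p = (x₀,y₀) ≠ 0` the cap-0 condition `|u|² + |v|² ≤ 3|p|²` reads `|τ|² + |ρ|² ≤ 3`. [folklore] -/
theorem jointRel_cap0_iff {x₀ y₀ : ℝ} (hp : 0 < x₀ ^ 2 + y₀ ^ 2) (τ ρ : Fin 2 → ℝ) :
    (x₀ * τ 0 - y₀ * ρ 0) ^ 2 + (x₀ * τ 1 - y₀ * ρ 1) ^ 2 + (y₀ * τ 0 + x₀ * ρ 0) ^ 2 + (y₀ * τ 1 + x₀ * ρ 1) ^ 2 ≤ 3 * (x₀ ^ 2 + y₀ ^ 2) ↔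
      τ 0 ^ 2 + τ 1 ^ 2 + (ρ 0 ^ 2 + ρ 1 ^ 2) ≤ 3 := by
  have e : (x₀ * τ 0 - y₀ * ρ 0) ^ 2 + (x₀ * τ 1 - y₀ * ρ 1) ^ 2 + (y₀ * τ 0 + x₀ * ρ 0) ^ 2 + (y₀ * τ 1 + x₀ * ρ 1) ^ 2 =
      (x₀ ^ 2 + y₀ ^ 2) * (τ 0 ^ 2 + τ 1 ^ 2 + (ρ 0 ^ 2 + ρ 1 ^ 2)) := by ring
  rw [e]
  constructor
  · intro h; nlinarith [h, hp]
  · intro h; nlinarith [h, hp]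

omit [NeZero L] in
/-- ✓`tipRot_letters` for EVERY unit `u` with `rot3 u e₀ = (1,τ)/λ`. [folklore] -/
theorem tipRot_letters_of_rot {u : ℍ} (hu : ‖u‖ = 1) (p : ℝ × ℝ) (τ ρ : Fin 2 → ℝ)
    (hrot : rot3 u ![1, 0, 0] = (Real.sqrt (1 + (τ 0 ^ 2 + τ 1 ^ 2)))⁻¹ • (![1, τ 0, τ 1] : Fin 3 → ℝ)) (z : Fin 3 → ℝ) (F : Fol L → Fin 3 → ℝ) :
    gnoRot (star u) ((((![p.1, p.1 * τ 0 - p.2 * ρ 0, p.1 * τ 1 - p.2 * ρ 1] : Fin 3 → ℝ),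
        (![p.2, p.2 * τ 0 + p.1 * ρ 0, p.2 * τ 1 + p.1 * ρ 1] : Fin 3 → ℝ)), (z, F)) : GnoCoord L) =
      gnoBase (Real.sqrt (1 + (τ 0 ^ 2 + τ 1 ^ 2)) * p.1) (Real.sqrt (1 + (τ 0 ^ 2 + τ 1 ^ 2)) * p.2) +
        gnoRot (star u) ((((![0, -(p.2 * ρ 0), -(p.2 * ρ 1)] : Fin 3 → ℝ), (![0, p.1 * ρ 0, p.1 * ρ 1] : Fin 3 → ℝ)), (z, F)) : GnoCoord L) := by
  set lam : ℝ := Real.sqrt (1 + (τ 0 ^ 2 + τ 1 ^ 2)) with hlam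
  have hlam0 : 0 < lam := Real.sqrt_pos.2 (by positivity)
  have hax : ∀ c : ℝ, rot3 u (![c, 0, 0] : Fin 3 → ℝ) = (![c * lam⁻¹, c * lam⁻¹ * τ 0, c * lam⁻¹ * τ 1] : Fin 3 → ℝ) := fun c => by
    have e : (![c, 0, 0] : Fin 3 → ℝ) = c • (![1, 0, 0] : Fin 3 → ℝ) := by
      ext i; fin_cases i <;> simp
    rw [e, rot3_smul, hrot, smul_smul]
    ext i; fin_cases i <;> simp [smul_eq_mul]
  have hbase : gnoRot u (gnoBase (lam * p.1) (lam * p.2) : GnoCoord L) =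
      ((((![p.1, p.1 * τ 0, p.1 * τ 1] : Fin 3 → ℝ), (![p.2, p.2 * τ 0, p.2 * τ 1] : Fin 3 → ℝ)), ((0 : Fin 3 → ℝ), (0 : Fol L → Fin 3 → ℝ))) : GnoCoord L) := by
    have hl : lam * p.1 * lam⁻¹ = p.1 := by field_simp
    have hl' : lam * p.2 * lam⁻¹ = p.2 := by field_simp
    refine Prod.ext (Prod.ext ?_ ?_) (Prod.ext ?_ (funext fun f => ?_))
    · show rot3 u (![lam * p.1, 0, 0] : Fin 3 → ℝ) = _; rw [hax, hl]
    · show rot3 u (![lam * p.2, 0, 0] : Fin 3 → ℝ) = _; rw [hax, hl']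
    · show rot3 u (0 : Fin 3 → ℝ) = 0; exact rot3_zero u
    · show rot3 u (0 : Fin 3 → ℝ) = (0 : Fol L → Fin 3 → ℝ) f; rw [rot3_zero]; rfl
  have hsplit : ((((![p.1, p.1 * τ 0 - p.2 * ρ 0, p.1 * τ 1 - p.2 * ρ 1] : Fin 3 → ℝ),
          (![p.2, p.2 * τ 0 + p.1 * ρ 0, p.2 * τ 1 + p.1 * ρ 1] : Fin 3 → ℝ)), (z, F)) : GnoCoord L) =
      ((((![p.1, p.1 * τ 0, p.1 * τ 1] : Fin 3 → ℝ), (![p.2, p.2 * τ 0, p.2 * τ 1] : Fin 3 → ℝ)), ((0 : Fin 3 → ℝ), (0 : Fol L → Fin 3 → ℝ))) : GnoCoord L) +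
        ((((![0, -(p.2 * ρ 0), -(p.2 * ρ 1)] : Fin 3 → ℝ), (![0, p.1 * ρ 0, p.1 * ρ 1] : Fin 3 → ℝ)), (z, F)) : GnoCoord L) := by
    refine Prod.ext (Prod.ext (funext fun i => ?_) (funext fun i => ?_)) (Prod.ext ?_ ?_)
    · fin_cases i <;> simp <;> ring
    · fin_cases i <;> simp
    · simp
    · simp
  rw [hsplit, gnoRot_add, ← hbase, gnoRot_star_gnoRot hu]

omit [NeZero L] in
/-- ★ **THE AXIAL LETTERS AFTER THE ROTATION** (exact): `ζ.x₀ = λx₀ − y₀(τ·ρ)/λ`, `ζ.y₀ = λy₀ + x₀(τ·ρ)/λ`. [folklore] -/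
theorem tipRot_axial {u : ℍ} (hu : ‖u‖ = 1) (p : ℝ × ℝ) (τ ρ : Fin 2 → ℝ)
    (hrot : rot3 u ![1, 0, 0] = (Real.sqrt (1 + (τ 0 ^ 2 + τ 1 ^ 2)))⁻¹ • (![1, τ 0, τ 1] : Fin 3 → ℝ)) (z : Fin 3 → ℝ) (F : Fol L → Fin 3 → ℝ) :
    (gnoBase (Real.sqrt (1 + (τ 0 ^ 2 + τ 1 ^ 2)) * p.1) (Real.sqrt (1 + (τ 0 ^ 2 + τ 1 ^ 2)) * p.2) +
          gnoRot (star u) ((((![0, -(p.2 * ρ 0), -(p.2 * ρ 1)] : Fin 3 → ℝ), (![0, p.1 * ρ 0, p.1 * ρ 1] : Fin 3 → ℝ)), (z, F)) : GnoCoord L)).1.1 0 =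
        Real.sqrt (1 + (τ 0 ^ 2 + τ 1 ^ 2)) * p.1 - (Real.sqrt (1 + (τ 0 ^ 2 + τ 1 ^ 2)))⁻¹ * (p.2 * (τ 0 * ρ 0 + τ 1 * ρ 1)) ∧
      (gnoBase (Real.sqrt (1 + (τ 0 ^ 2 + τ 1 ^ 2)) * p.1) (Real.sqrt (1 + (τ 0 ^ 2 + τ 1 ^ 2)) * p.2) +
          gnoRot (star u) ((((![0, -(p.2 * ρ 0), -(p.2 * ρ 1)] : Fin 3 → ℝ), (![0, p.1 * ρ 0, p.1 * ρ 1] : Fin 3 → ℝ)), (z, F)) : GnoCoord L)).1.2 0 =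
        Real.sqrt (1 + (τ 0 ^ 2 + τ 1 ^ 2)) * p.2 + (Real.sqrt (1 + (τ 0 ^ 2 + τ 1 ^ 2)))⁻¹ * (p.1 * (τ 0 * ρ 0 + τ 1 * ρ 1)) := by
  set lam : ℝ := Real.sqrt (1 + (τ 0 ^ 2 + τ 1 ^ 2)) with hlam
  set sx : Fin 3 → ℝ := ![0, -(p.2 * ρ 0), -(p.2 * ρ 1)] with hsx
  set sy : Fin 3 → ℝ := ![0, p.1 * ρ 0, p.1 * ρ 1] with hsy
  have hdx : rot3 (star u) sx 0 = -(lam⁻¹ * (p.2 * (τ 0 * ρ 0 + τ 1 * ρ 1))) := by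
    rw [rot3_star_apply_zero hu, hrot, hsx, Fin.sum_univ_three]; simp; ring
  have hdy : rot3 (star u) sy 0 = lam⁻¹ * (p.1 * (τ 0 * ρ 0 + τ 1 * ρ 1)) := by
    rw [rot3_star_apply_zero hu, hrot, hsy, Fin.sum_univ_three]; simp; ring
  constructor
  · show (![lam * p.1, 0, 0] : Fin 3 → ℝ) 0 + rot3 (star u) sx 0 = _
    rw [hdx]; simp; ring
  · show (![lam * p.2, 0, 0] : Fin 3 → ℝ) 0 + rot3 (star u) sy 0 = _
    rw [hdy]; simp

omit [NeZero L] in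
/-- The letter sizes are rotation invariant: `|ζ.x|² = |x|²`, `|ζ.y|² = |y|²`, `|ζ.z|² = |z|²` for `ζ = gnoRot v η`, `‖v‖ = 1`. [folklore] -/
theorem normSq3_gnoRot {v : ℍ} (hv : ‖v‖ = 1) (η : GnoCoord L) :
    normSq3 (gnoRot v η).1.1 = normSq3 η.1.1 ∧ normSq3 (gnoRot v η).1.2 = normSq3 η.1.2 ∧ normSq3 (gnoRot v η).2.1 = normSq3 η.2.1 := by
  obtain ⟨e1, e2, e3, -⟩ := gnoRot_apply v η
  rw [e1, e2, e3]
  exact ⟨normSq3_rot3 hv _, normSq3_rot3 hv _, normSq3_rot3 hv _⟩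

/-- ★★ **THE COMPRESSED TRANSVERSE SIZES** of the rotated tip point `ζ = gnoBase (λx₀) (λy₀) + gnoRot ū stiff` (= `gnoRot ū η` by `tipRot_letters_of_rot`) over
`p ≠ 0`, ANY tilts: `|ζ.x⊥|²/(1+|x|²) ≤ 450L⁶F̂(η)·(1+|y|²)/|p|²` and `|ζ.y⊥|²/(1+|y|²) ≤ 450L⁶F̂(η)·(1+|x|²)/|p|²` (`|ζ.x|² = |x|²` by `normSq3_gnoRot`) —
any hub `a`, any followers; from ✓`tipRot_transverse_sq` and the cross floor ✓`gnoDeficit_floor_cross`. [cite: Luscher1983, §2] -/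
theorem tip_transverse_compressed_le (a : ℍ) (ε : GnoSign L) {u : ℍ} (hu : ‖u‖ = 1) {p : ℝ × ℝ} (hp : 0 < p.1 ^ 2 + p.2 ^ 2) (τ ρ : Fin 2 → ℝ)
    (hrot : rot3 u ![1, 0, 0] = (Real.sqrt (1 + (τ 0 ^ 2 + τ 1 ^ 2)))⁻¹ • (![1, τ 0, τ 1] : Fin 3 → ℝ)) (z : Fin 3 → ℝ) (F : Fol L → Fin 3 → ℝ) :
    (((gnoBase (Real.sqrt (1 + (τ 0 ^ 2 + τ 1 ^ 2)) * p.1) (Real.sqrt (1 + (τ 0 ^ 2 + τ 1 ^ 2)) * p.2) +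
          gnoRot (star u) ((((![0, -(p.2 * ρ 0), -(p.2 * ρ 1)] : Fin 3 → ℝ), (![0, p.1 * ρ 0, p.1 * ρ 1] : Fin 3 → ℝ)), (z, F)) : GnoCoord L)).1.1 1) ^ 2 +
        ((gnoBase (Real.sqrt (1 + (τ 0 ^ 2 + τ 1 ^ 2)) * p.1) (Real.sqrt (1 + (τ 0 ^ 2 + τ 1 ^ 2)) * p.2) +
          gnoRot (star u) ((((![0, -(p.2 * ρ 0), -(p.2 * ρ 1)] : Fin 3 → ℝ), (![0, p.1 * ρ 0, p.1 * ρ 1] : Fin 3 → ℝ)), (z, F)) : GnoCoord L)).1.1 2) ^ 2)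
        / (1 + normSq3 (![p.1, p.1 * τ 0 - p.2 * ρ 0, p.1 * τ 1 - p.2 * ρ 1] : Fin 3 → ℝ)) ≤
      450 * (L : ℝ) ^ 6 * gnoDeficit (fun _ => false) (fun _ => 1) a ε ((((![p.1, p.1 * τ 0 - p.2 * ρ 0, p.1 * τ 1 - p.2 * ρ 1] : Fin 3 → ℝ),
          (![p.2, p.2 * τ 0 + p.1 * ρ 0, p.2 * τ 1 + p.1 * ρ 1] : Fin 3 → ℝ)), (z, F)) : GnoCoord L) *
        (1 + normSq3 (![p.2, p.2 * τ 0 + p.1 * ρ 0, p.2 * τ 1 + p.1 * ρ 1] : Fin 3 → ℝ)) / (p.1 ^ 2 + p.2 ^ 2) ∧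
    (((gnoBase (Real.sqrt (1 + (τ 0 ^ 2 + τ 1 ^ 2)) * p.1) (Real.sqrt (1 + (τ 0 ^ 2 + τ 1 ^ 2)) * p.2) +
          gnoRot (star u) ((((![0, -(p.2 * ρ 0), -(p.2 * ρ 1)] : Fin 3 → ℝ), (![0, p.1 * ρ 0, p.1 * ρ 1] : Fin 3 → ℝ)), (z, F)) : GnoCoord L)).1.2 1) ^ 2 +
        ((gnoBase (Real.sqrt (1 + (τ 0 ^ 2 + τ 1 ^ 2)) * p.1) (Real.sqrt (1 + (τ 0 ^ 2 + τ 1 ^ 2)) * p.2) +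
          gnoRot (star u) ((((![0, -(p.2 * ρ 0), -(p.2 * ρ 1)] : Fin 3 → ℝ), (![0, p.1 * ρ 0, p.1 * ρ 1] : Fin 3 → ℝ)), (z, F)) : GnoCoord L)).1.2 2) ^ 2)
        / (1 + normSq3 (![p.2, p.2 * τ 0 + p.1 * ρ 0, p.2 * τ 1 + p.1 * ρ 1] : Fin 3 → ℝ)) ≤
      450 * (L : ℝ) ^ 6 * gnoDeficit (fun _ => false) (fun _ => 1) a ε ((((![p.1, p.1 * τ 0 - p.2 * ρ 0, p.1 * τ 1 - p.2 * ρ 1] : Fin 3 → ℝ),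
          (![p.2, p.2 * τ 0 + p.1 * ρ 0, p.2 * τ 1 + p.1 * ρ 1] : Fin 3 → ℝ)), (z, F)) : GnoCoord L) *
        (1 + normSq3 (![p.1, p.1 * τ 0 - p.2 * ρ 0, p.1 * τ 1 - p.2 * ρ 1] : Fin 3 → ℝ)) / (p.1 ^ 2 + p.2 ^ 2) := by
  obtain ⟨hX, hY⟩ := tipRot_transverse_sq (L := L) hu p τ ρ hrot z F
  rw [hX, hY]
  clear hX hY hrot
  set x : Fin 3 → ℝ := ![p.1, p.1 * τ 0 - p.2 * ρ 0, p.1 * τ 1 - p.2 * ρ 1] with hx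
  set y : Fin 3 → ℝ := ![p.2, p.2 * τ 0 + p.1 * ρ 0, p.2 * τ 1 + p.1 * ρ 1] with hy
  have hlam2 : 1 ≤ 1 + (τ 0 ^ 2 + τ 1 ^ 2) := by nlinarith [sq_nonneg (τ 0), sq_nonneg (τ 1)]
  have hlpos : 0 < 1 + (τ 0 ^ 2 + τ 1 ^ 2) := by positivity
  set T : ℝ := (ρ 0 ^ 2 + ρ 1 ^ 2) + (τ 0 * ρ 1 - τ 1 * ρ 0) ^ 2 with hT
  have hT0 : 0 ≤ T := by positivity
  -- the cross floor in joint/relative letters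
  have hC := gnoDeficit_floor_cross (L := L) a ε (((x, y), (z, F)) : GnoCoord L)
  dsimp only at hC
  have ecross : (x 1 * y 2 - x 2 * y 1) ^ 2 + (x 2 * y 0 - x 0 * y 2) ^ 2 + (x 0 * y 1 - x 1 * y 0) ^ 2 = (p.1 ^ 2 + p.2 ^ 2) ^ 2 * T := by
    rw [hT, hx, hy]
    simp only [Matrix.cons_val_zero, Matrix.cons_val_one, Matrix.head_cons, Matrix.cons_val_two, Matrix.tail_cons]
    ring
  have eSx : 1 + ((x 0) ^ 2 + (x 1) ^ 2 + (x 2) ^ 2) = 1 + normSq3 x := by rw [normSq3_eq_three']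
  have eSy : 1 + ((y 0) ^ 2 + (y 1) ^ 2 + (y 2) ^ 2) = 1 + normSq3 y := by rw [normSq3_eq_three']
  rw [ecross, eSx, eSy] at hC
  set G : ℝ := gnoDeficit (fun _ => false) (fun _ => 1) a ε (((x, y), (z, F)) : GnoCoord L) with hG
  have hG0 : 0 ≤ G := gnoDeficit_nonneg _ _ _ _ _
  have hSx : 0 < 1 + normSq3 x := by rw [normSq3_eq_three']; positivity
  have hSy : 0 < 1 + normSq3 y := by rw [normSq3_eq_three']; positivity
  set P : ℝ := p.1 ^ 2 + p.2 ^ 2 with hP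
  clear_value x y T G P
  have hkey : P ^ 2 * T ≤ 450 * (L : ℝ) ^ 6 * G * (1 + normSq3 x) * (1 + normSq3 y) := by
    rw [div_le_iff₀ (by positivity)] at hC
    nlinarith [hC]
  have hp2 : p.2 ^ 2 ≤ P := by rw [hP]; exact le_add_of_nonneg_left (sq_nonneg p.1)
  have hp1 : p.1 ^ 2 ≤ P := by rw [hP]; exact le_add_of_nonneg_right (sq_nonneg p.2)
  constructor
  · rw [div_le_iff₀ hSx]
    have h1 : p.2 ^ 2 / (1 + (τ 0 ^ 2 + τ 1 ^ 2)) * T ≤ P * T :=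
      mul_le_mul_of_nonneg_right ((div_le_self (sq_nonneg _) hlam2).trans hp2) hT0
    have h3 : P * T ≤ 450 * (L : ℝ) ^ 6 * G * (1 + normSq3 y) / P * (1 + normSq3 x) := by
      rw [div_mul_eq_mul_div, le_div_iff₀ hp]
      calc P * T * P = P ^ 2 * T := by ring
        _ ≤ 450 * (L : ℝ) ^ 6 * G * (1 + normSq3 x) * (1 + normSq3 y) := hkey
        _ = 450 * (L : ℝ) ^ 6 * G * (1 + normSq3 y) * (1 + normSq3 x) := by ring
    exact h1.trans h3
  · rw [div_le_iff₀ hSy]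
    have h1 : p.1 ^ 2 / (1 + (τ 0 ^ 2 + τ 1 ^ 2)) * T ≤ P * T :=
      mul_le_mul_of_nonneg_right ((div_le_self (sq_nonneg _) hlam2).trans hp1) hT0
    have h3 : P * T ≤ 450 * (L : ℝ) ^ 6 * G * (1 + normSq3 x) / P * (1 + normSq3 y) := by
      rw [div_mul_eq_mul_div, le_div_iff₀ hp]
      calc P * T * P = P ^ 2 * T := by ring
        _ ≤ 450 * (L : ℝ) ^ 6 * G * (1 + normSq3 x) * (1 + normSq3 y) := hkey
    exact h1.trans h3

end Summit.QuantumFields.YangMills.Theorems.SwapVirialDeficit.BlowUpRing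

end
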